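import Summits.QuantumFields.YangMills.Theorems.SmallFieldWideningLargeFieldMassRefinementTailElementaryEnvelopeProfile

/-!
# Route `RenyiTelescope` — glue item `HistoryTailOfRenyiTelescope` (stmt-QuantumFields-27139): THE ARITHMETIC CLOSURE
# (support file; ideator seat `ym-r3-idea-2` g3, registered stub `stub_arithClosure` of the glue skeleton v7)

Pure real analysis, no measures.  The instantiation of the glue (`Theorems/RenyiTelescopeGlueRest.lean`) needs, for every family `F`,
coupling `0 < γ ≤ 1`, profile `b₀ > 0, p₀ > 0` and constants `η, Q > 0`, fine-regime cut-offs `J₀(d) ≥ 1` such that for all depths `d ≥ h₀`: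
`γL^(−d)·L^(J₀(d))·p(g_d)² ≤ η` (the fine regime of crux `FineRegimeUnitTailL` reaches `J₀(d)`), `Q·L^(2J₀(d)) ≥ 3` (the telescope's orders are
admissible) and `p(g_d)⁴·L^(3(m+d)) ≤ L^(4J₀(d))` (the telescope's exponent is `≤ 4R₀`), where `p(g_d) = b₀(1 + ½(d·log L − log γ))^(p₀)`
(`pFun_coupling_eq`).  We take `J₀(d) = d − ⌊d/8⌋`: with `t = ⌊d/8⌋` all three conditions follow from `γβ²(t+1)^(2N) ≤ ηL^t`, `3 ≤ QL^t`,
`βL^m(t+1)^N ≤ L^t` (`N = ⌈p₀⌉`, `β = b₀(8α)^(p₀)`, `α = 1 + ½log L − ½log γ`, so that `p(g_d) ≤ β(t+1)^(p₀) ≤ β(t+1)^N`), i.e. from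
"polynomial ≤ exponential eventually" (`exists_poly_le_pow`, from Mathlib's `tendsto_pow_const_div_const_pow_of_one_lt`).

WHAT THIS IS NOT: no Gibbs measure appears; nothing here bears on the cruxes, the rung R3 or the mass gap; `YM3TorusSU2` is NOT proved.

References: T. Bałaban, CMP 102 (1985) 255–275 [Balaban1985UV3] ((7) p.257: the thresholds `p(g) = b₀(1 + log g⁻¹)^(p₀)`).
-/

noncomputable section

open Filter
open Literature.MathematicalPhysics.QuantumFieldTheory.Balaban1983to89
open Literature.MathematicalPhysics.QuantumFieldTheory.Balaban1983to89.T3ContinuumYM3Torus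
open Summit.QuantumFields.YangMills.Theorems.LargeFieldMassRefinementTailElementaryEnvelope

namespace Summit.QuantumFields.YangMills.Theorems.RenyiTelescope

/-- **POLYNOMIAL ≤ EXPONENTIAL, EVENTUALLY**: for `r > 1`, `M·(t+1)^k ≤ r^t` for all large `t`. [folklore] -/
theorem exists_poly_le_pow (M : ℝ) (k : ℕ) {r : ℝ} (hr : 1 < r) :
    ∃ t₀ : ℕ, ∀ t : ℕ, t₀ ≤ t → M * ((t : ℝ) + 1) ^ k ≤ r ^ t := by
  have hr0 : 0 < r := one_pos.trans hr
  have h1 : Tendsto (fun t : ℕ => (((t + 1 : ℕ) : ℝ)) ^ k / r ^ (t + 1)) atTop (nhds 0) :=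
    (tendsto_pow_const_div_const_pow_of_one_lt k hr).comp (tendsto_add_atTop_nat 1)
  have h2 := h1.const_mul (|M| * r)
  rw [mul_zero] at h2
  obtain ⟨t₀, ht₀⟩ := eventually_atTop.mp (h2.eventually (eventually_le_nhds one_pos))
  refine ⟨t₀, fun t ht => ?_⟩
  have h := ht₀ t ht
  have hrt : 0 < r ^ t := pow_pos hr0 t
  have e : |M| * r * ((((t + 1 : ℕ) : ℝ)) ^ k / r ^ (t + 1)) = |M| * ((t : ℝ) + 1) ^ k / r ^ t := by
    rw [pow_succ]
    push_cast
    field_simp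
  rw [e, div_le_one hrt] at h
  exact (mul_le_mul_of_nonneg_right (le_abs_self M) (by positivity)).trans h

/-- **REGISTERED STUB `stub_arithClosure` OF THE GLUE SKELETON v7 (item stmt-QuantumFields-27139)** — the arithmetic closure of the
instantiation: fine-regime cut-offs `J₀(d) = d − ⌊d/8⌋`. [cite: Balaban1985UV3, (7) p.257] -/
theorem stub_arithClosure :
    ∀ (F : T3Family) (γ b₀ p₀ η Q : ℝ), 0 < γ → γ ≤ 1 → 0 < b₀ → 0 < p₀ → 0 < η → 0 < Q →
      ∃ (h₀ : ℕ) (J₀ : ℕ → ℕ), ∀ d, h₀ ≤ d →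
        1 ≤ J₀ d ∧
        γ * ((F.L : ℝ)⁻¹) ^ d * (F.L : ℝ) ^ (J₀ d) * (B10.pFun b₀ p₀ (Real.sqrt (γ * ((F.L : ℝ)⁻¹) ^ d))) ^ 2 ≤ η ∧
        3 ≤ Q * (F.L : ℝ) ^ (2 * J₀ d) ∧
        (B10.pFun b₀ p₀ (Real.sqrt (γ * ((F.L : ℝ)⁻¹) ^ d))) ^ 4 * (F.L : ℝ) ^ (3 * (F.m + d)) ≤ (F.L : ℝ) ^ (4 * J₀ d) := by
  intro F γ b₀ p₀ η Q hγ hγ1 hb₀ hp₀ hη hQ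
  have hL1 : (1 : ℝ) < F.L := by exact_mod_cast F.hL.2
  have hL0 : (0 : ℝ) < F.L := one_pos.trans hL1
  have hℓ0 : 0 < Real.log F.L := Real.log_pos hL1
  have hlogγ : Real.log γ ≤ 0 := Real.log_nonpos hγ.le hγ1
  -- the polynomial envelope of `p(g_d)`: `p(g_d) ≤ β·(⌊d/8⌋ + 1)^p₀ ≤ β·(⌊d/8⌋ + 1)^N`
  set α : ℝ := 1 + Real.log F.L / 2 - Real.log γ / 2 with hα
  have hα1 : 1 ≤ α := by rw [hα]; linarith [hℓ0.le]
  set β : ℝ := b₀ * (8 * α) ^ p₀ with hβ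
  have hβ0 : 0 < β := by positivity
  set N : ℕ := ⌈p₀⌉₊ with hN
  have hp_le : ∀ d : ℕ, B10.pFun b₀ p₀ (Real.sqrt (γ * ((F.L : ℝ)⁻¹) ^ d)) ≤ β * (((d / 8 : ℕ) : ℝ) + 1) ^ N := by
    intro d
    rw [pFun_coupling_eq F hγ b₀ p₀ d]
    have hd8 : (d : ℝ) + 1 ≤ 8 * (((d / 8 : ℕ) : ℝ) + 1) := by
      have h : d + 1 ≤ 8 * (d / 8 + 1) := by omega
      have h' : ((d + 1 : ℕ) : ℝ) ≤ ((8 * (d / 8 + 1) : ℕ) : ℝ) := by exact_mod_cast h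
      push_cast at h'
      linarith
    have hu0 : 0 ≤ 1 + ((d : ℝ) * Real.log F.L - Real.log γ) / 2 := by
      have : 0 ≤ (d : ℝ) * Real.log F.L := by positivity
      linarith
    have hule : 1 + ((d : ℝ) * Real.log F.L - Real.log γ) / 2 ≤ (8 * α) * (((d / 8 : ℕ) : ℝ) + 1) := by
      have h1 : 1 + ((d : ℝ) * Real.log F.L - Real.log γ) / 2 ≤ α * ((d : ℝ) + 1) := by
        rw [hα]
        nlinarith [mul_nonneg (neg_nonneg.mpr hlogγ) (Nat.cast_nonneg d : (0 : ℝ) ≤ d), (Nat.cast_nonneg d : (0 : ℝ) ≤ d),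
          mul_nonneg hℓ0.le (Nat.cast_nonneg d : (0 : ℝ) ≤ d)]
      calc 1 + ((d : ℝ) * Real.log F.L - Real.log γ) / 2 ≤ α * ((d : ℝ) + 1) := h1
        _ ≤ α * (8 * (((d / 8 : ℕ) : ℝ) + 1)) := mul_le_mul_of_nonneg_left hd8 (by linarith)
        _ = (8 * α) * (((d / 8 : ℕ) : ℝ) + 1) := by ring
    have ht1 : (1 : ℝ) ≤ ((d / 8 : ℕ) : ℝ) + 1 := by
      have : (0 : ℝ) ≤ ((d / 8 : ℕ) : ℝ) := Nat.cast_nonneg _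
      linarith
    calc b₀ * (1 + ((d : ℝ) * Real.log F.L - Real.log γ) / 2) ^ p₀ ≤ b₀ * ((8 * α) * (((d / 8 : ℕ) : ℝ) + 1)) ^ p₀ :=
          mul_le_mul_of_nonneg_left (Real.rpow_le_rpow hu0 hule hp₀.le) hb₀.le
      _ = β * (((d / 8 : ℕ) : ℝ) + 1) ^ p₀ := by
          rw [hβ, Real.mul_rpow (by positivity) (by positivity)]
          ring
      _ ≤ β * (((d / 8 : ℕ) : ℝ) + 1) ^ (N : ℝ) :=
          mul_le_mul_of_nonneg_left (Real.rpow_le_rpow_of_exponent_le ht1 (Nat.le_ceil p₀)) hβ0.le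
      _ = β * (((d / 8 : ℕ) : ℝ) + 1) ^ N := by rw [Real.rpow_natCast]
  -- the three eventual conditions in `t = ⌊d/8⌋`
  obtain ⟨t₂, ht₂⟩ := exists_poly_le_pow (γ * β ^ 2 / η) (2 * N) hL1
  obtain ⟨t₃, ht₃⟩ := exists_poly_le_pow (3 / Q) 0 hL1
  obtain ⟨t₄, ht₄⟩ := exists_poly_le_pow (β * (F.L : ℝ) ^ F.m) N hL1
  refine ⟨8 * max t₂ (max t₃ t₄) + 8, fun d => d - d / 8, fun d hd => ?_⟩
  have hT : max t₂ (max t₃ t₄) ≤ d / 8 := by omega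
  have ht₂d : t₂ ≤ d / 8 := (le_max_left _ _).trans hT
  have ht₃d : t₃ ≤ d / 8 := ((le_max_left _ _).trans (le_max_right _ _)).trans hT
  have ht₄d : t₄ ≤ d / 8 := ((le_max_right _ _).trans (le_max_right _ _)).trans hT
  set p : ℝ := B10.pFun b₀ p₀ (Real.sqrt (γ * ((F.L : ℝ)⁻¹) ^ d)) with hp
  have hg0 : 0 < γ * ((F.L : ℝ)⁻¹) ^ d := by positivity
  have hg1 : γ * ((F.L : ℝ)⁻¹) ^ d ≤ 1 :=
    mul_le_one₀ hγ1 (by positivity) (pow_le_one₀ (by positivity) (inv_le_one_of_one_le₀ hL1.le))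
  have hp0 : 0 ≤ p :=
    B10.pFun_nonneg b₀ p₀ _ hb₀.le (Real.sqrt_pos.mpr hg0) ((Real.sqrt_le_sqrt hg1).trans_eq Real.sqrt_one)
  have hpN : p ≤ β * (((d / 8 : ℕ) : ℝ) + 1) ^ N := hp_le d
  have hLt : 0 < (F.L : ℝ) ^ (d / 8) := by positivity
  refine ⟨Nat.le_sub_of_add_le (by omega), ?_, ?_, ?_⟩
  · -- the fine regime reaches `J₀(d)`: `γ·p²/L^t ≤ η`
    have hsplit : (F.L : ℝ) ^ d = (F.L : ℝ) ^ (d - d / 8) * (F.L : ℝ) ^ (d / 8) := by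
      rw [← pow_add, Nat.sub_add_cancel (Nat.div_le_self d 8)]
    have e : ((F.L : ℝ)⁻¹) ^ d * (F.L : ℝ) ^ (d - d / 8) = ((F.L : ℝ) ^ (d / 8))⁻¹ := by
      rw [inv_pow, hsplit]
      field_simp
    have h2 := ht₂ (d / 8) ht₂d
    calc γ * ((F.L : ℝ)⁻¹) ^ d * (F.L : ℝ) ^ (d - d / 8) * p ^ 2 = γ * p ^ 2 * ((F.L : ℝ) ^ (d / 8))⁻¹ := by
          rw [mul_assoc γ, e]
          ring
      _ ≤ γ * (β * (((d / 8 : ℕ) : ℝ) + 1) ^ N) ^ 2 * ((F.L : ℝ) ^ (d / 8))⁻¹ := by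
          gcongr
      _ = (γ * β ^ 2 / η * (((d / 8 : ℕ) : ℝ) + 1) ^ (2 * N)) * (η * ((F.L : ℝ) ^ (d / 8))⁻¹) := by
          rw [pow_mul', mul_pow]
          field_simp
      _ ≤ (F.L : ℝ) ^ (d / 8) * (η * ((F.L : ℝ) ^ (d / 8))⁻¹) := mul_le_mul_of_nonneg_right h2 (by positivity)
      _ = η := by field_simp
  · -- the telescope's orders are admissible: `3 ≤ Q·L^t ≤ Q·L^(2J₀(d))`
    have h3 := ht₃ (d / 8) ht₃d
    rw [pow_zero, mul_one, div_le_iff₀ hQ] at h3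
    calc (3 : ℝ) ≤ (F.L : ℝ) ^ (d / 8) * Q := h3
      _ ≤ (F.L : ℝ) ^ (2 * (d - d / 8)) * Q :=
          mul_le_mul_of_nonneg_right (pow_le_pow_right₀ hL1.le (by omega)) hQ.le
      _ = Q * (F.L : ℝ) ^ (2 * (d - d / 8)) := mul_comm _ _
  · -- the telescope's exponent: `p⁴·L^(3(m+d)) ≤ L^(4J₀(d))` from `p·L^m ≤ L^t`
    have h4 := ht₄ (d / 8) ht₄d
    have hpm : p * (F.L : ℝ) ^ F.m ≤ (F.L : ℝ) ^ (d / 8) :=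
      le_trans (by nlinarith [mul_le_mul_of_nonneg_right hpN (pow_pos hL0 F.m).le]) h4
    have key : p ^ 4 * (F.L : ℝ) ^ (4 * F.m) ≤ (F.L : ℝ) ^ (4 * (d / 8)) := by
      calc p ^ 4 * (F.L : ℝ) ^ (4 * F.m) = (p * (F.L : ℝ) ^ F.m) ^ 4 := by rw [mul_pow, ← pow_mul, mul_comm F.m 4]
        _ ≤ ((F.L : ℝ) ^ (d / 8)) ^ 4 := pow_le_pow_left₀ (by positivity) hpm 4
        _ = (F.L : ℝ) ^ (4 * (d / 8)) := by rw [← pow_mul, mul_comm (d / 8) 4]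
    have hmul : p ^ 4 * (F.L : ℝ) ^ (3 * (F.m + d)) * (F.L : ℝ) ^ (4 * F.m) ≤
        (F.L : ℝ) ^ (4 * (d - d / 8)) * (F.L : ℝ) ^ (4 * F.m) := by
      calc p ^ 4 * (F.L : ℝ) ^ (3 * (F.m + d)) * (F.L : ℝ) ^ (4 * F.m)
          = (p ^ 4 * (F.L : ℝ) ^ (4 * F.m)) * (F.L : ℝ) ^ (3 * (F.m + d)) := by ring
        _ ≤ (F.L : ℝ) ^ (4 * (d / 8)) * (F.L : ℝ) ^ (3 * (F.m + d)) := mul_le_mul_of_nonneg_right key (by positivity)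
        _ = (F.L : ℝ) ^ (4 * (d / 8) + 3 * (F.m + d)) := (pow_add _ _ _).symm
        _ ≤ (F.L : ℝ) ^ (4 * (d - d / 8) + 4 * F.m) := pow_le_pow_right₀ hL1.le (by omega)
        _ = (F.L : ℝ) ^ (4 * (d - d / 8)) * (F.L : ℝ) ^ (4 * F.m) := pow_add _ _ _
    exact le_of_mul_le_mul_right hmul (by positivity)

end Summit.QuantumFields.YangMills.Theorems.RenyiTelescope

end
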